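import Mathlib
import Literature.Analysis.FluidPDE.ClassicalLocalEnergyWindow
import HarnessLib

/-!
# Route RootDecompLitSlice — cell Uᶜ `CritTameScarIsCritical` (stmt-NavierStokesRegularity-31733):
# the windowed LOCAL ENERGY FLUX BUDGET (classical local energy identity with a cut-off)

Helpers toward the Tao-vacuous cell Uᶜ (`--supports 31733`; no item, no node, no registered stub).
STℓ (`LocalWindowTradeoff.localWindowTradeoff`) carries a LOCAL DISSIPATION NUMBER
`L ≥ ν∫∫_{window × B_ρ}|∇u|²_F` as a hypothesis. This file is the first half of its discharge: the
LOCAL ENERGY IDENTITY of a classical solution against a spatial cut-off (tree: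
`IsClassicalNSSolutionOn.local_energy_identity_cutoff`, `ClassicalLocalEnergyCutoff.lean`) keeps
the dissipation, and the flux side is bounded exactly as in the tree's
`IsClassicalNSSolutionOn.integral_cutoff_norm_sq_sub_le_window` (which keeps only the energy
growth and drops the dissipation):

* `LocalEnergyBudget.fluxIntegral_le_window` — classical solution on an open time set `S`,
  `φ ∈ C_c^∞`, `tsupport φ ⊆ B(x₀,R)`, `‖Dφ‖ ≤ C_g`, `|Δφ| ≤ C_L`, `[t₀,t₁] ⊆ S`, any gauge `c(t)`:
  `∫_{t₀}^{t₁}∫(νΔφ|u|² + Dφ(u)|u|² + 2pDφ(u)) ≤ νC_L a(t₁−t₀) + C_g m₃ + 2C_g m_{pu}` where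
  `a ≥ ∫_{B(x₀,R)}|u(t)|²` on the window, `m₃ ≥ ∬|u|³`, `m_{pu} ≥ ∬|p − c(t)||u|` on
  `(t₀,t₁) × B(x₀,R)` — the genuinely nonlinear inputs (cubic and gauged pressure FLUX through
  the collar) are explicit hypothesis NUMBERS bounding explicit integrals (critic row 665 (c3));
* `LocalEnergyBudget.dissipation_le_window` — hence
  `2ν∫_{t₀}^{t₁}∫|∇u|²_F φ ≤ (∫φ|u(t₀)|² − ∫φ|u(t₁)|²) + νC_L a(t₁−t₀) + C_g m₃ + 2C_g m_{pu}`.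

The terminal-window version on the frame `[0,T)` (exhaustion `t₁ ↑ T`), the release bound from
the window modulus and the assembled STℓ corollary are in `RootDecompLitSliceLocalEnergyBudget`.

HONEST FRAMING: helper lemmas INSIDE the Tao-vacuous cell Uᶜ; zero load of the route moves
(ROOT ⟺ U ∧ P1, critic rows 354/371/563/639/665); no item is re-typed. Rung 0: nothing here proves
NS regularity. Decomp-ns route-writer g39. [folklore]
-/

set_option linter.dupNamespace false

noncomputable section

namespace Summit.NavierStokesRegularity.NavierStokesRegularity.Theorems

open MeasureTheory TopologicalSpace Set Function Filter Metric
open _root_.Topology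
open scoped Laplacian InnerProductSpace RealInnerProductSpace ENNReal NNReal ContDiff
open Literature.Analysis.FluidPDE

namespace LocalEnergyBudget

section Generic

variable {E : Type*} [NormedAddCommGroup E] [InnerProductSpace ℝ E] [FiniteDimensional ℝ E]
  [MeasurableSpace E] [BorelSpace E]
variable {S : Set ℝ} {ν : ℝ} {u : ℝ → E → E} {p : ℝ → E → ℝ}

/-- **The time-integrated flux is controlled by three window quantities** (the flux half of the
tree's `IsClassicalNSSolutionOn.integral_cutoff_norm_sq_sub_le_window`, same proof). Classical
solution of the unforced system with `ν ≥ 0` on an open time set `S`; `φ ∈ C_c^∞(E)` with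
`tsupport φ ⊆ B(x₀,R)`, `‖Dφ‖ ≤ C_g`, `|Δφ| ≤ C_L`; `t₀ ≤ t₁`, `[t₀,t₁] ⊆ S`; `c` any gauge. If
`∫_{B(x₀,R)}|u(t)|² ≤ a` on `[t₀,t₁]`, `∬_{(t₀,t₁)×B(x₀,R)}|u|³ ≤ m₃` and `|p − c(t)||u|` is integrable
on the window with `∬|p − c(t)||u| ≤ m_{pu}`, then
`∫_{t₀}^{t₁}∫(νΔφ|u|² + Dφ(u)|u|² + 2pDφ(u)) ≤ νC_L a(t₁−t₀) + C_g m₃ + 2C_g m_{pu}`.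
[cite: CaffarelliKohnNirenberg1982, §2 (2.5)] -/
theorem fluxIntegral_le_window
    (h : IsClassicalNSSolutionOn S ν 0 u p) (hν : 0 ≤ ν) {φ : E → ℝ}
    (hφ : ContDiff ℝ ∞ φ) (hφc : HasCompactSupport φ)
    {x₀ : E} {R Cg CL : ℝ} (hsupp : tsupport φ ⊆ ball x₀ R)
    (hD : ∀ x, ‖fderiv ℝ φ x‖ ≤ Cg) (hΔ : ∀ x, |(Δ φ) x| ≤ CL) (hCg : 0 ≤ Cg)
    {t₀ t₁ : ℝ} (ht₀₁ : t₀ ≤ t₁) (hI : Icc t₀ t₁ ⊆ S)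
    {a : ℝ} (ha : ∀ s ∈ Icc t₀ t₁, ∫ x in ball x₀ R, ‖u s x‖ ^ 2 ≤ a)
    {c : ℝ → ℝ} {m₃ mpu : ℝ}
    (h3 : ∫ z in Ioo t₀ t₁ ×ˢ ball x₀ R, ‖u z.1 z.2‖ ^ 3 ≤ m₃)
    (hq : IntegrableOn (fun z : ℝ × E => |p z.1 z.2 - c z.1| * ‖u z.1 z.2‖)
      (Ioo t₀ t₁ ×ˢ ball x₀ R))
    (hpu : ∫ z in Ioo t₀ t₁ ×ˢ ball x₀ R, |p z.1 z.2 - c z.1| * ‖u z.1 z.2‖ ≤ mpu) :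
    ∫ s in t₀..t₁, ∫ x, (ν * ((Δ φ) x * ‖u s x‖ ^ 2) +
        fderiv ℝ φ x (u s x) * ‖u s x‖ ^ 2 + 2 * (p s x * fderiv ℝ φ x (u s x))) ≤
      ν * CL * a * (t₁ - t₀) + Cg * m₃ + 2 * Cg * mpu := by
  -- Step 0: notation and basic facts
  set B : Set E := ball x₀ R with hB
  set I : Set ℝ := Ioo t₀ t₁ with hIdef
  set Φ : ℝ → ℝ := fun s => ∫ x, (ν * ((Δ φ) x * ‖u s x‖ ^ 2) +
    fderiv ℝ φ x (u s x) * ‖u s x‖ ^ 2 + 2 * (p s x * fderiv ℝ φ x (u s x))) with hΦ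
  set c₃ : ℝ → ℝ := fun s => ∫ x in B, ‖u s x‖ ^ 3 with hc₃
  set k : ℝ → ℝ := fun s => ∫ x in B, |p s x - c s| * ‖u s x‖ with hk
  have hIS : I ⊆ S := fun s hs => hI (Ioo_subset_Icc_self hs)
  have hCL : 0 ≤ CL := (abs_nonneg _).trans (hΔ x₀)
  have ha0 : 0 ≤ a :=
    le_trans (integral_nonneg fun x => by positivity) (ha t₀ (left_mem_Icc.2 ht₀₁))
  -- supports of `Δφ`, `Dφ` inside the ball
  have hΔ0 : ∀ x ∉ B, (Δ φ) x = 0 := fun x hx =>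
    laplacian_eq_zero_of_notMem_tsupport fun h' => hx (hsupp h')
  have hD0 : ∀ x ∉ B, fderiv ℝ φ x = 0 := fun x hx =>
    fderiv_of_notMem_tsupport ℝ fun h' => hx (hsupp h')
  -- Step 2: the interval integral of the flux as a set integral over `I`
  have cΦ : ContinuousOn Φ S := h.continuousOn_integral_flux_cutoff hφ hφc
  have iΦI : IntegrableOn Φ I :=
    ((cΦ.mono hI).integrableOn_compact isCompact_Icc).mono_set Ioo_subset_Icc_self
  have h2 : ∫ s in t₀..t₁, Φ s = ∫ s in I, Φ s := by
    rw [intervalIntegral.integral_of_le ht₀₁, integral_Ioc_eq_integral_Ioo]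
  -- Step 3: Fubini for `|u|³` and `|p - c| |u|` on the window
  have hprod : (volume.restrict (I ×ˢ B) : Measure (ℝ × E)) =
      (volume.restrict I).prod (volume.restrict B) := by
    rw [Measure.volume_eq_prod, Measure.prod_restrict]
  have i3 : Integrable (fun z : ℝ × E => ‖u z.1 z.2‖ ^ 3)
      ((volume.restrict I).prod (volume.restrict B)) := by
    rw [← hprod]; exact h.integrableOn_norm_pow_three_window hI x₀ R
  have iq : Integrable (fun z : ℝ × E => |p z.1 z.2 - c z.1| * ‖u z.1 z.2‖)
      ((volume.restrict I).prod (volume.restrict B)) := by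
    rw [← hprod]; exact hq
  have hc₃I : Integrable c₃ (volume.restrict I) := i3.integral_prod_left
  have hkI : Integrable k (volume.restrict I) := iq.integral_prod_left
  have hc₃eq : ∫ s in I, c₃ s = ∫ z in I ×ˢ B, ‖u z.1 z.2‖ ^ 3 := by
    rw [hprod, integral_prod _ i3]
  have hkeq : ∫ s in I, k s = ∫ z in I ×ˢ B, |p z.1 z.2 - c z.1| * ‖u z.1 z.2‖ := by
    rw [hprod, integral_prod _ iq]
  -- slices of the gauged pressure term are integrable for a.e. time
  have hqslice : ∀ᵐ s ∂(volume.restrict I),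
      Integrable (fun x => |p s x - c s| * ‖u s x‖) (volume.restrict B) := iq.prod_right_ae
  -- Step 4: the a.e. pointwise bound `Φ ≤ ν C_L a + C_g c₃ + 2 C_g k` on `I`
  have hpt : ∀ᵐ s ∂(volume.restrict I), Φ s ≤ ν * CL * a + Cg * c₃ s + 2 * Cg * k s := by
    filter_upwards [hqslice, ae_restrict_mem measurableSet_Ioo] with s hqs hs
    have hΦs : Φ s = ∫ x, (ν * ((Δ φ) x * ‖u s x‖ ^ 2) +
        fderiv ℝ φ x (u s x) * ‖u s x‖ ^ 2 + 2 * (p s x * fderiv ℝ φ x (u s x))) := rfl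
    rw [hΦs]
    have hsS : s ∈ S := hIS hs
    have hsI : s ∈ Icc t₀ t₁ := Ioo_subset_Icc_self hs
    have hu : Continuous (u s) := (h.contDiff_velocity hsS).continuous
    have hflux := h.integral_flux_le hφ hφc hsS (c s)
    -- (i) the Laplacian term
    have iu2 : IntegrableOn (fun x => ‖u s x‖ ^ 2) B :=
      ((hu.norm.pow 2).continuousOn.integrableOn_compact (isCompact_closedBall x₀ R)).mono_set
        ball_subset_closedBall
    have b1 : ∫ x, |(Δ φ) x| * ‖u s x‖ ^ 2 ≤ CL * a := by
      rw [integral_eq_setIntegral_of_forall_notMem_eq_zero (s := B)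
        (fun x hx => by rw [hΔ0 x hx, abs_zero, zero_mul])]
      calc ∫ x in B, |(Δ φ) x| * ‖u s x‖ ^ 2 ≤ ∫ x in B, CL * ‖u s x‖ ^ 2 := by
            refine setIntegral_mono_on ?_ (iu2.const_mul CL) measurableSet_ball fun x _ => ?_
            · exact (iu2.const_mul CL).mono' ((((continuous_abs.comp (continuous_laplacian
                (hφ.of_le (by norm_cast)))).mul (hu.norm.pow 2)).aestronglyMeasurable))
                (Eventually.of_forall fun x => by
                  rw [Real.norm_eq_abs, abs_mul, abs_abs, abs_of_nonneg (sq_nonneg ‖u s x‖)]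
                  exact mul_le_mul_of_nonneg_right (hΔ x) (sq_nonneg _))
            · exact mul_le_mul_of_nonneg_right (hΔ x) (by positivity)
        _ = CL * ∫ x in B, ‖u s x‖ ^ 2 := integral_const_mul _ _
        _ ≤ CL * a := mul_le_mul_of_nonneg_left (ha s hsI) hCL
    -- (ii) the cubic term
    have iu3 : IntegrableOn (fun x => ‖u s x‖ ^ 3) B :=
      ((hu.norm.pow 3).continuousOn.integrableOn_compact (isCompact_closedBall x₀ R)).mono_set
        ball_subset_closedBall
    have b2 : ∫ x, ‖fderiv ℝ φ x‖ * ‖u s x‖ ^ 3 ≤ Cg * c₃ s := by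
      rw [integral_eq_setIntegral_of_forall_notMem_eq_zero (s := B)
        (fun x hx => by rw [hD0 x hx, norm_zero, zero_mul])]
      calc ∫ x in B, ‖fderiv ℝ φ x‖ * ‖u s x‖ ^ 3 ≤ ∫ x in B, Cg * ‖u s x‖ ^ 3 := by
            refine setIntegral_mono_on ?_ (iu3.const_mul Cg) measurableSet_ball fun x _ => ?_
            · exact (iu3.const_mul Cg).mono'
                ((((hφ.of_le (by norm_cast) : ContDiff ℝ 1 φ).continuous_fderiv
                  one_ne_zero).norm.mul (hu.norm.pow 3)).aestronglyMeasurable)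
                (Eventually.of_forall fun x => by
                  rw [Real.norm_eq_abs, abs_mul (‖fderiv ℝ φ x‖) (‖u s x‖ ^ 3), abs_norm,
                    abs_of_nonneg (pow_nonneg (norm_nonneg (u s x)) 3)]
                  exact mul_le_mul_of_nonneg_right (hD x) (pow_nonneg (norm_nonneg _) 3))
            · exact mul_le_mul_of_nonneg_right (hD x) (by positivity)
        _ = Cg * c₃ s := integral_const_mul _ _
    -- (iii) the gauged pressure term (slice integrable at this `s`)
    have b3 : ∫ x, |p s x - c s| * ‖fderiv ℝ φ x‖ * ‖u s x‖ ≤ Cg * k s := by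
      rw [integral_eq_setIntegral_of_forall_notMem_eq_zero (s := B)
        (fun x hx => by rw [hD0 x hx, norm_zero, mul_zero, zero_mul])]
      have hqs' : IntegrableOn (fun x => Cg * (|p s x - c s| * ‖u s x‖)) B := hqs.const_mul Cg
      calc ∫ x in B, |p s x - c s| * ‖fderiv ℝ φ x‖ * ‖u s x‖
          ≤ ∫ x in B, Cg * (|p s x - c s| * ‖u s x‖) := by
            refine setIntegral_mono_on ?_ hqs' measurableSet_ball fun x _ => ?_
            · refine hqs'.mono' ?_ (Eventually.of_forall fun x => ?_)
              · have hp : Continuous (p s) := (h.contDiff_pressure hsS).continuous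
                exact ((((continuous_abs.comp (hp.sub continuous_const)).mul
                  (((hφ.of_le (by norm_cast) : ContDiff ℝ 1 φ).continuous_fderiv
                    one_ne_zero).norm)).mul hu.norm).aestronglyMeasurable)
              · rw [Real.norm_eq_abs, abs_of_nonneg (by positivity)]
                calc |p s x - c s| * ‖fderiv ℝ φ x‖ * ‖u s x‖
                    = ‖fderiv ℝ φ x‖ * (|p s x - c s| * ‖u s x‖) := by ring
                  _ ≤ Cg * (|p s x - c s| * ‖u s x‖) :=
                    mul_le_mul_of_nonneg_right (hD x) (by positivity)
            · calc |p s x - c s| * ‖fderiv ℝ φ x‖ * ‖u s x‖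
                  = ‖fderiv ℝ φ x‖ * (|p s x - c s| * ‖u s x‖) := by ring
                _ ≤ Cg * (|p s x - c s| * ‖u s x‖) :=
                  mul_le_mul_of_nonneg_right (hD x) (by positivity)
        _ = Cg * k s := integral_const_mul _ _
    have hνabs : |ν| = ν := abs_of_nonneg hν
    rw [hνabs] at hflux
    have : ν * ∫ x, |(Δ φ) x| * ‖u s x‖ ^ 2 ≤ ν * (CL * a) := mul_le_mul_of_nonneg_left b1 hν
    linarith
  -- Step 5: integrate over `I`
  have hvolI : (volume.restrict I) univ = ENNReal.ofReal (t₁ - t₀) := by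
    rw [Measure.restrict_apply_univ, hIdef, Real.volume_Ioo]
  haveI : IsFiniteMeasure (volume.restrict I) := ⟨by rw [hvolI]; exact ENNReal.ofReal_lt_top⟩
  have hAB : Integrable (fun s => ν * CL * a + Cg * c₃ s) (volume.restrict I) :=
    (integrable_const _).add (hc₃I.const_mul Cg)
  have hRHS : Integrable (fun s => ν * CL * a + Cg * c₃ s + 2 * Cg * k s) (volume.restrict I) :=
    hAB.add (hkI.const_mul (2 * Cg))
  have h5 : ∫ s in I, Φ s ≤ ∫ s in I, (ν * CL * a + Cg * c₃ s + 2 * Cg * k s) :=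
    integral_mono_ae iΦI hRHS hpt
  have h6 : ∫ s in I, (ν * CL * a + Cg * c₃ s + 2 * Cg * k s) =
      ν * CL * a * (t₁ - t₀) + Cg * (∫ s in I, c₃ s) + 2 * Cg * ∫ s in I, k s := by
    have eA : ∫ s in I, (ν * CL * a + Cg * c₃ s + 2 * Cg * k s) =
        (∫ s in I, (ν * CL * a + Cg * c₃ s)) + ∫ s in I, 2 * Cg * k s :=
      integral_add hAB (hkI.const_mul (2 * Cg))
    have eB : ∫ s in I, (ν * CL * a + Cg * c₃ s) =
        (∫ _ in I, (ν * CL * a)) + ∫ s in I, Cg * c₃ s :=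
      integral_add (integrable_const _) (hc₃I.const_mul Cg)
    have eC : ∫ s in I, Cg * c₃ s = Cg * ∫ s in I, c₃ s := integral_const_mul _ _
    have eD : ∫ s in I, 2 * Cg * k s = 2 * Cg * ∫ s in I, k s := integral_const_mul _ _
    have eE : ∫ _ in I, (ν * CL * a) = ν * CL * a * (t₁ - t₀) := by
      rw [integral_const, smul_eq_mul, measureReal_def, hvolI, ENNReal.toReal_ofReal (by linarith)]
      ring
    rw [eA, eB, eC, eD, eE]
  -- Step 6: assemble
  have hc₃le : ∫ s in I, c₃ s ≤ m₃ := by rw [hc₃eq]; exact h3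
  have hkle : ∫ s in I, k s ≤ mpu := by rw [hkeq]; exact hpu
  have e1 : Cg * (∫ s in I, c₃ s) ≤ Cg * m₃ := mul_le_mul_of_nonneg_left hc₃le hCg
  have e2 : 2 * Cg * (∫ s in I, k s) ≤ 2 * Cg * mpu :=
    mul_le_mul_of_nonneg_left hkle (by positivity)
  calc ∫ s in t₀..t₁, Φ s = ∫ s in I, Φ s := h2
    _ ≤ ν * CL * a * (t₁ - t₀) + Cg * (∫ s in I, c₃ s) + 2 * Cg * ∫ s in I, k s := by
        rw [← h6]; exact h5
    _ ≤ ν * CL * a * (t₁ - t₀) + Cg * m₃ + 2 * Cg * mpu := by linarith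

/-- **The localised dissipation over a window is paid by the local energy release and the three
flux quantities**: under the hypotheses of `fluxIntegral_le_window`,
`2ν ∫_{t₀}^{t₁}∫ |∇u|²_F φ ≤ (∫φ|u(t₀)|² − ∫φ|u(t₁)|²) + νC_L a(t₁−t₀) + C_g m₃ + 2C_g m_{pu}`
(the local energy identity `IsClassicalNSSolutionOn.local_energy_identity_cutoff` plus the flux
bound). [cite: CaffarelliKohnNirenberg1982, §2 (2.5)] -/
theorem dissipation_le_window
    (h : IsClassicalNSSolutionOn S ν 0 u p) (hS : IsOpen S) (hν : 0 ≤ ν) {φ : E → ℝ}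
    (hφ : ContDiff ℝ ∞ φ) (hφc : HasCompactSupport φ)
    {x₀ : E} {R Cg CL : ℝ} (hsupp : tsupport φ ⊆ ball x₀ R)
    (hD : ∀ x, ‖fderiv ℝ φ x‖ ≤ Cg) (hΔ : ∀ x, |(Δ φ) x| ≤ CL) (hCg : 0 ≤ Cg)
    {t₀ t₁ : ℝ} (ht₀₁ : t₀ ≤ t₁) (hI : Icc t₀ t₁ ⊆ S)
    {a : ℝ} (ha : ∀ s ∈ Icc t₀ t₁, ∫ x in ball x₀ R, ‖u s x‖ ^ 2 ≤ a)
    {c : ℝ → ℝ} {m₃ mpu : ℝ}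
    (h3 : ∫ z in Ioo t₀ t₁ ×ˢ ball x₀ R, ‖u z.1 z.2‖ ^ 3 ≤ m₃)
    (hq : IntegrableOn (fun z : ℝ × E => |p z.1 z.2 - c z.1| * ‖u z.1 z.2‖)
      (Ioo t₀ t₁ ×ˢ ball x₀ R))
    (hpu : ∫ z in Ioo t₀ t₁ ×ˢ ball x₀ R, |p z.1 z.2 - c z.1| * ‖u z.1 z.2‖ ≤ mpu) :
    2 * ν * ∫ s in t₀..t₁, ∫ x, frobeniusNormSq (fderiv ℝ (u s) x) * φ x ≤
      ((∫ x, φ x * ‖u t₀ x‖ ^ 2) - ∫ x, φ x * ‖u t₁ x‖ ^ 2) +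
        (ν * CL * a * (t₁ - t₀) + Cg * m₃ + 2 * Cg * mpu) := by
  have hid := h.local_energy_identity_cutoff hS hφ hφc ht₀₁ hI
  have hfl := fluxIntegral_le_window h hν hφ hφc hsupp hD hΔ hCg ht₀₁ hI ha h3 hq hpu
  linarith

end Generic

end LocalEnergyBudget

end Summit.NavierStokesRegularity.NavierStokesRegularity.Theorems

end
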